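import Literature.Analysis.FluidPDE.ParabolicRescale
import Literature.Analysis.FluidPDE.NSBoundedMildOseen
import Literature.Analysis.FluidPDE.OseenKernelScaling
import Mathlib.MeasureTheory.Measure.Haar.NormedSpace
import HarnessLib

/-!
# The Duhamel term under the parabolic rescaling: `B^ν_0(v,w)(t₀θ, √(νt₀)ξ) = √(t₀/ν) B^1_0(ṽ,w̃)(θ, ξ)`

Analysis/FluidPDE file on the discharge path of the named fact
`Literature.Analysis.FluidPDE.knss2009_local_smoothing` (`NSBoundedMildSmoothing.lean`;
Koch–Nadirashvili–Seregin–Šverák, Acta Math. 203 (2009) = arXiv:0709.3599, §4 p. 8). The weighted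
bilinear estimate (B) of `NSBoundedMildWeightedPicard.lean` is proved at **unit parabolic scale**
and transported to every scale `t₀` by the parabolic rescaling of `ParabolicRescale.lean`. This
file proves the transport identity for the bilinear Duhamel term
`B^ν_s(v,w)(t)(x) = ∫ₛᵗ∫ K(ν(t-τ), x-y)[v(τ,y), w(τ,y)] dy dτ` (`oseenDuhamel`,
`NSBoundedMildOseen.lean`): for `ν, t₀ > 0` and all fields `v, w`,

  `parabolicRescale ν t₀ (B^ν_0(v, w)) (θ, ξ) = √(t₀/ν) • B^1_0(ṽ, w̃)(θ)(ξ)`,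

`ṽ = curry (parabolicRescale ν t₀ v)`, i.e. `ṽ(σ, η) = v(t₀σ, √(νt₀)η)` (`oseenDuhamel_parabolicRescale`):
the time substitution `τ = t₀σ` (`setIntegral_Ioo_comp_mul_left`), the space substitution
`y = √(νt₀)η` (Haar change of variables, `Measure.integral_comp_smul_of_nonneg`) and the parabolic
homogeneity `K(λ²σ, λz) = λ^{-(d+1)}K(σ, z)` of the Oseen kernel (`oseenKernel_sq_mul_smul`,
`OseenKernelScaling.lean`; Koch–Tataru 2001, (8), (14)); `t₀ · √(νt₀)^d · √(νt₀)^{-(d+1)} = √(t₀/ν)`.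
This is the Navier–Stokes scaling `u ↦ λu(λx, λ²t)` of KNSS 2009, §1 (1.3), for the bilinear
form `B` of §4 p. 8, with the viscosity normalised. No integrability hypothesis is needed (both
substitutions are identities of Bochner integrals for arbitrary integrands).

## References

* G. Koch, N. Nadirashvili, G. Seregin, V. Šverák, Acta Math. 203 (2009) = arXiv:0709.3599,
  §1 (1.3), §4 p. 8 (the bilinear form `B`). [KochNadirashviliSereginSverak2009]
* H. Koch, D. Tataru, Adv. Math. 157 (2001), §2 (8), §3 (14). [KochTataruAdvMath2001]
-/

noncomputable section

open MeasureTheory Set Function Filter Metric Real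
open _root_.Topology
open scoped ENNReal NNReal RealInnerProductSpace

namespace Literature.Analysis.FluidPDE

/-! ### Time substitution in set integrals over `(0, θ)` -/

section Time

variable {F : Type*} [NormedAddCommGroup F] [NormedSpace ℝ F]

/-- **Linear time substitution**: `∫_{σ ∈ (0, θ)} f(cσ) dσ = c⁻¹ ∫_{τ ∈ (0, cθ)} f(τ) dτ` for
`c > 0` (any integrand; Haar change of variables on `ℝ`). [folklore] -/
theorem setIntegral_Ioo_comp_mul_left (f : ℝ → F) {c : ℝ} (hc : 0 < c) (θ : ℝ) :
    ∫ σ in Ioo 0 θ, f (c * σ) = c⁻¹ • ∫ τ in Ioo 0 (c * θ), f τ := by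
  rw [← integral_indicator measurableSet_Ioo, ← integral_indicator measurableSet_Ioo,
    ← abs_of_pos (inv_pos.mpr hc), ← Measure.integral_comp_mul_left]
  congr 1
  ext1 σ
  simp only [Set.indicator, Set.mem_Ioo]
  have h1 : (0 < c * σ ∧ c * σ < c * θ) ↔ (0 < σ ∧ σ < θ) := by
    constructor
    · rintro ⟨h0, hθ⟩
      exact ⟨pos_of_mul_pos_right h0 hc.le, lt_of_mul_lt_mul_left hθ hc.le⟩
    · rintro ⟨h0, hθ⟩
      exact ⟨mul_pos hc h0, mul_lt_mul_of_pos_left hθ hc⟩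
  simp only [h1]

end Time

/-! ### The transport identity -/

section Transport

variable {E : Type*} [NormedAddCommGroup E] [InnerProductSpace ℝ E] [FiniteDimensional ℝ E]
  [MeasurableSpace E] [BorelSpace E]

/-- **Space substitution in an Oseen slice**: for `L > 0`, `σ > 0` and any fields `a, b`,
`∫ K(L²σ, Lξ - y)[a(y), b(y)] dy = L⁻¹ ∫ K(σ, ξ - η)[a(Lη), b(Lη)] dη` (Haar change of variables
`y = Lη` and the homogeneity `K(L²σ, Lz) = L^{-(d+1)}K(σ, z)`). [cite: KochTataruAdvMath2001, §2 (8) and §3 (14)] -/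
theorem integral_oseenKernel_sq_mul_smul {L : ℝ} (hL : 0 < L) {σ : ℝ} (hσ : 0 < σ) (a b : E → E)
    (ξ : E) :
    ∫ y, oseenKernel (L ^ 2 * σ) (L • ξ - y) (a y) (b y) =
      L⁻¹ • ∫ η, oseenKernel σ (ξ - η) (a (L • η)) (b (L • η)) := by
  set d : ℕ := Module.finrank ℝ E with hd
  set f : E → E := fun y => oseenKernel (L ^ 2 * σ) (L • ξ - y) (a y) (b y) with hf
  have hsub := Measure.integral_comp_smul_of_nonneg (μ := (volume : Measure E)) f L (hR := hL.le)
  have hpt : ∀ η : E, f (L • η) = (L ^ (d + 1))⁻¹ • oseenKernel σ (ξ - η) (a (L • η)) (b (L • η)) := by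
    intro η
    simp only [hf, ← smul_sub, oseenKernel_sq_mul_smul hL hσ, hd]
  have hLd : (L ^ d : ℝ) ≠ 0 := pow_ne_zero d hL.ne'
  change ∫ y, f y = _
  have h2 : ∫ y, f y = L ^ d • ∫ η, f (L • η) := by
    rw [hsub, smul_smul, mul_inv_cancel₀ hLd, one_smul]
  rw [h2]
  simp_rw [hpt]
  rw [integral_smul, smul_smul]
  congr 1
  rw [pow_succ, mul_inv, ← mul_assoc, mul_inv_cancel₀ hLd, one_mul]

/-- **The Duhamel term under the parabolic rescaling** (KNSS 2009, §1 (1.3) for the bilinear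
form `B` of §4 p. 8, viscosity normalised): for `ν, t₀ > 0`, all fields `v, w` and all `(θ, ξ)`,
`parabolicRescale ν t₀ (B^ν_0(v,w)) (θ, ξ) = √(t₀/ν) • B^1_0(ṽ, w̃)(θ)(ξ)` with
`ṽ = curry (parabolicRescale ν t₀ v)`, `w̃ = curry (parabolicRescale ν t₀ w)`.
[cite: KochNadirashviliSereginSverak2009, §1 (1.3) and §4 p. 8 (arXiv:0709.3599)] -/
theorem oseenDuhamel_parabolicRescale {ν t₀ : ℝ} (hν : 0 < ν) (ht₀ : 0 < t₀) (v w : ℝ → E → E)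
    (p : ℝ × E) :
    parabolicRescale ν t₀ (oseenDuhamel ν 0 v w) p =
      Real.sqrt (t₀ / ν) • oseenDuhamel 1 0 (curry (parabolicRescale ν t₀ v))
        (curry (parabolicRescale ν t₀ w)) p.1 p.2 := by
  set L : ℝ := Real.sqrt (ν * t₀) with hL
  have hL0 : 0 < L := Real.sqrt_pos.2 (mul_pos hν ht₀)
  have hL2 : L ^ 2 = ν * t₀ := by rw [hL, Real.sq_sqrt (mul_pos hν ht₀).le]
  rw [parabolicRescale_apply, oseenDuhamel_apply, oseenDuhamel_apply]
  -- time substitution `τ = t₀ σ`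
  have htime := setIntegral_Ioo_comp_mul_left
    (fun τ => ∫ y, oseenKernel (ν * (t₀ * p.1 - τ)) (L • p.2 - y) (v τ y) (w τ y)) ht₀ p.1
  rw [← hL]
  have htime' : ∫ τ in Ioo 0 (t₀ * p.1), ∫ y, oseenKernel (ν * (t₀ * p.1 - τ)) (L • p.2 - y) (v τ y) (w τ y) =
      t₀ • ∫ σ in Ioo 0 p.1, ∫ y, oseenKernel (ν * (t₀ * p.1 - t₀ * σ)) (L • p.2 - y) (v (t₀ * σ) y)
        (w (t₀ * σ) y) := by
    rw [htime, smul_smul, mul_inv_cancel₀ ht₀.ne', one_smul]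
  rw [htime']
  -- space substitution inside, for `σ < θ`
  have hspace : ∀ σ ∈ Ioo 0 p.1,
      ∫ y, oseenKernel (ν * (t₀ * p.1 - t₀ * σ)) (L • p.2 - y) (v (t₀ * σ) y) (w (t₀ * σ) y) =
        L⁻¹ • ∫ η, oseenKernel (1 * (p.1 - σ)) (p.2 - η) (curry (parabolicRescale ν t₀ v) σ η)
          (curry (parabolicRescale ν t₀ w) σ η) := by
    intro σ hσ
    have hpos : 0 < p.1 - σ := sub_pos.2 hσ.2
    have hsc : ν * (t₀ * p.1 - t₀ * σ) = L ^ 2 * (p.1 - σ) := by rw [hL2]; ring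
    rw [hsc, integral_oseenKernel_sq_mul_smul hL0 hpos, one_mul]
    rfl
  rw [setIntegral_congr_fun measurableSet_Ioo hspace, integral_smul, smul_smul]
  congr 1
  -- `√(t₀/ν) = t₀ L⁻¹`
  have hsν : 0 < Real.sqrt ν := Real.sqrt_pos.2 hν
  have hst : 0 < Real.sqrt t₀ := Real.sqrt_pos.2 ht₀
  rw [hL, Real.sqrt_div ht₀.le, Real.sqrt_mul hν.le, eq_div_iff hsν.ne', mul_inv,
    show t₀ * ((Real.sqrt ν)⁻¹ * (Real.sqrt t₀)⁻¹) * Real.sqrt ν =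
      t₀ * (Real.sqrt t₀)⁻¹ * ((Real.sqrt ν)⁻¹ * Real.sqrt ν) by ring,
    inv_mul_cancel₀ hsν.ne', mul_one, mul_inv_eq_iff_eq_mul₀ hst.ne', Real.mul_self_sqrt ht₀.le]

end Transport

end Literature.Analysis.FluidPDE

end
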